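import Mathlib.Analysis.SpecialFunctions.Sqrt
import Mathlib.Analysis.Calculus.ContDiff.Operations
import Mathlib.Analysis.Normed.Group.Bounded
import Mathlib.Algebra.BigOperators.Fin
import HarnessLib

/-!
# The geometric lemma of convex integration (Nash; De Lellis–Székelyhidi) in every dimension:
rank-one decomposition of symmetric matrices near the identity along finitely many lattice directions

A. Cheskidov, X. Luo, *Sharp nonuniqueness for the Navier–Stokes equations*, Invent. Math. 229
(2022) = arXiv:2009.06596, §4.1, Lemma 4.2 (the device goes back to J. Nash, *C¹ isometric
imbeddings*, Ann. of Math. 60 (1954); CL22 attribute the printed version to De Lellis and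
Székelyhidi):

> **Lemma 4.2.** For any compact subset `𝒩 ⊂ 𝒮₊^{d×d}`, there exists a finite set `Λ ⊂ ℤ^d` and
> smooth functions `Γ_k ∈ C^∞(𝒩; ℝ)` for any `k ∈ Λ` such that
> `R = ∑_{k ∈ Λ} Γ_k²(R) e_k ⊗ e_k` for all `R ∈ 𝒩`, where `e_k = k/|k|`.

CL22 apply it once, with `𝒩 = B_{1/2}(Id)` (§4.1), to build the amplitudes
`a_k = θ g_κ ρ^{1/2} Γ_k(Id - R̄/ρ)` of the Mikado flows (§4.4, (4.12)); any fixed neighbourhood of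
`Id` serves there, the divisor `ρ` being at one's disposal. This file PROVES the lemma for the
compact neighbourhoods `𝒩 = B̄(Id, ρ)`, `ρ ≤ 2 r_d`, `r_d = 1/(5(d-1))`, of the identity in
**every dimension `d ≥ 2`** (`d` any finite index type), with explicit data — the first
general-dimensional instance in the tree (the `3 × 3` instance with Coiculescu–Palasek's six
directions is `Literature.Analysis.FluidPDE.CP25.nash_lemma`):

* directions `NashGeometric.dir`, indexed by `NashGeometric.Index d = d ⊕ (P ⊕ P)` with
  `P = {(i, j) : i ≠ j}`: `e_i`, `e_i + 2e_j`, `e_i - 2e_j` — nonzero and pairwise distinct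
  (`dir_ne_zero`, `dir_injective`: they enumerate a genuine finite subset `Λ ⊂ ℤ^d`), of squared
  length `1`, `5`, `5` (`sum_sq_dir`);
* squared coefficients `NashGeometric.coeffSq`, AFFINE in `M`:
  `Γ²_{e_i}(M) = M_ii - 1/2`, `Γ²_{e_i ± 2e_j}(M) = r_d/4 ± M_ij/8`;
* the LINEAR identity `∑_x Γ_x²(M) (k_x)_a (k_x)_b = (M_ab + M_ba)/2` for every matrix `M`
  (`sum_coeffSq_mul_dir_mul_dir`; `d ≥ 2` enters through the calibration
  `10 · (r_d/4) · (d-1) = 1/2`), whence `M = ∑_x Γ_x(M)² k_x ⊗ k_x` for symmetric `M` on the closed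
  sup-ball `B̄(Id, 2r_d)`, where all `Γ_x² ≥ 0` (`decomposition`);
* `Γ_x = √(Γ_x²)` is `C^∞` on the open sup-ball `B(Id, 2r_d)` (`contDiffOn_coeff`), with
  `Γ_x² ≥ r_d/8` on `B̄(Id, r_d)` (`le_coeffSq`) and all derivatives bounded on `B̄(Id, r_d)`
  (`exists_bound_iteratedFDeriv_coeff`);
* the lemma in its printed shapes: `geometric_lemma` (family form with un-normalised integer
  directions — the shape consumed by Mikado constructions and printed by Coiculescu–Palasek),
  `decomposition_unit` / `geometric_lemma_finset` (CL22's form: a finite SET `Λ ⊂ ℤ^d ∖ {0}` and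
  `R = ∑_{k ∈ Λ} Γ̃_k²(R) (k/|k|) ⊗ (k/|k|)`, `Γ̃_k² = |k|² Γ_k²`).

## Design

* `𝒮^{d×d}` is rendered inside the Pi type `d → d → ℝ` (sup norm — the instance under which
  `ContDiff`/`iteratedFDeriv` are canonical, as in `CP25`) with a symmetry hypothesis; `Id` is
  `NashGeometric.idMat`. Sup-balls contain the Frobenius balls of the same radius, so the
  statements cover the printed metric balls `B_ρ(Id) ∩ 𝒮`, `ρ ≤ 2r_d`.
* What is NOT here: the lemma for an ARBITRARY compact `𝒩 ⊂ 𝒮₊` (Nash's covering argument with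
  a partition of unity over many centres); only neighbourhoods of `Id` are used by the
  Navier–Stokes/Euler convex-integration schemes vendored in the tree (CL22 §4.3; CP25 Lemma 6.1).

## Mathlib / tree search

Mathlib (this pin) has no rank-one/Nash decomposition of symmetric matrices (searched `Nash`,
`rank_one`, `rankOne`: nothing relevant); tree: `CP25.nash_lemma` (`d = 3`, explicit six
directions; not reused: its directions and radius are specific to `Fin 3`). Used: `ContDiffOn.sqrt`,
`contDiff_apply_apply`, `IsCompact.exists_bound_of_continuousOn`, `Finset.sum_subtype`,
`Finset.filter_ne`, `Finset.sum_image`.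

## References

* A. Cheskidov, X. Luo, Invent. Math. 229 (2022) 987–1054 = arXiv:2009.06596, §4.1 Lemma 4.2 and
  the paragraph following it. [`CheskidovLuo2022`]
* M. P. Coiculescu, S. Palasek, Invent. Math. 244 (2025), App. A Lemma 6.1 (the `3 × 3` instance in
  the same un-normalised shape). [`CoiculescuPalasek2025`]
-/

noncomputable section

open Set Metric Finset
open scoped ContDiff

namespace Literature.Analysis.FluidPDE.NashGeometric

variable {d : Type*}

/-! ## Index type and directions -/

section Directions

variable (d) in
/-- Ordered pairs of distinct indices, `P = {(i, j) : i ≠ j}`. [folklore] -/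
abbrev Pair : Type _ := {p : d × d // p.1 ≠ p.2}

variable (d) in
/-- The index type of the direction family: `d ⊕ (P ⊕ P)` — one direction `e_i` per index `i`,
and two directions `e_i + 2e_j`, `e_i - 2e_j` per ordered pair `i ≠ j`.
[cite: CheskidovLuo2022, Lemma 4.2] -/
abbrev Index : Type _ := d ⊕ (Pair d ⊕ Pair d)

/-- Squared Euclidean length `|k_x|²` of the directions: `|e_i|² = 1`, `|e_i ± 2e_j|² = 5`. [folklore] -/
def dirNormSq : Index d → ℝ :=
  Sum.elim (fun _ => 1) (Sum.elim (fun _ => 5) (fun _ => 5))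

/-- `|e_i|² = 1`. [folklore] -/
@[simp] theorem dirNormSq_inl (i : d) : dirNormSq (Sum.inl i : Index d) = 1 := rfl

/-- `|e_i + 2e_j|² = 5`. [folklore] -/
@[simp] theorem dirNormSq_inr_inl (p : Pair d) : dirNormSq (Sum.inr (Sum.inl p) : Index d) = 5 := rfl

/-- `|e_i - 2e_j|² = 5`. [folklore] -/
@[simp] theorem dirNormSq_inr_inr (p : Pair d) : dirNormSq (Sum.inr (Sum.inr p) : Index d) = 5 := rfl

/-- `0 < |k_x|²`. [folklore] -/
theorem dirNormSq_pos (x : Index d) : 0 < dirNormSq x := by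
  rcases x with i | p | p <;> simp

variable [DecidableEq d]

/-- The lattice directions `k_x ∈ ℤ^d`: `e_i` for `x = i`, and `e_i + 2e_j` resp. `e_i - 2e_j`
for the two copies of the ordered pair `(i, j)`, `i ≠ j`. [cite: CheskidovLuo2022, Lemma 4.2] -/
def dir : Index d → d → ℤ :=
  Sum.elim (fun i => Pi.single i 1)
    (Sum.elim (fun p => Pi.single p.1.1 1 + 2 • Pi.single p.1.2 1)
      (fun p => Pi.single p.1.1 1 - 2 • Pi.single p.1.2 1))

/-- The index carrying the entry `1` of `k_x` (`i` in all three cases). [folklore] -/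
def base : Index d → d := Sum.elim id (Sum.elim (fun p => p.1.1) (fun p => p.1.1))

/-- Entries of the directions as integers. [folklore] -/
theorem dir_apply (x : Index d) (q : d) : dir x q =
    Sum.elim (fun i => if q = i then (1 : ℤ) else 0)
      (Sum.elim (fun p => (if q = p.1.1 then (1 : ℤ) else 0) + 2 * (if q = p.1.2 then 1 else 0))
        (fun p => (if q = p.1.1 then (1 : ℤ) else 0) - 2 * (if q = p.1.2 then 1 else 0))) x := by
  rcases x with i | p | p <;> simp [dir, Pi.single_apply]

/-- Entries of the directions as reals: `(e_i)_q = δ_qi`, `(e_i ± 2e_j)_q = δ_qi ± 2δ_qj`. [folklore] -/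
theorem dir_apply_cast (x : Index d) (q : d) : ((dir x q : ℤ) : ℝ) =
    Sum.elim (fun i => if q = i then (1 : ℝ) else 0)
      (Sum.elim (fun p => (if q = p.1.1 then (1 : ℝ) else 0) + 2 * (if q = p.1.2 then 1 else 0))
        (fun p => (if q = p.1.1 then (1 : ℝ) else 0) - 2 * (if q = p.1.2 then 1 else 0))) x := by
  rcases x with i | p | p <;> simp [dir, Pi.single_apply, Int.cast_ite]

/-- `(k_x)_q = 1` exactly at `q = base x`. [folklore] -/
theorem dir_eq_one_iff (x : Index d) (q : d) : dir x q = 1 ↔ q = base x := by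
  rw [dir_apply]
  rcases x with i | ⟨⟨i, j⟩, hij⟩ | ⟨⟨i, j⟩, hij⟩
  · simp only [Sum.elim_inl, base, id]
    split_ifs with h <;> simp [h]
  · dsimp only at hij ⊢
    simp only [base, Sum.elim_inr, Sum.elim_inl]
    by_cases hqi : q = i
    · subst hqi; simp [hij]
    · simp only [hqi, if_false, zero_add, iff_false]
      split_ifs <;> norm_num
  · dsimp only at hij ⊢
    simp only [base, Sum.elim_inr]
    by_cases hqi : q = i
    · subst hqi; simp [hij]
    · simp only [hqi, if_false, zero_sub, iff_false]
      split_ifs <;> norm_num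

/-- `(k_x)_q = 2` exactly when `x` is the first copy of a pair `(i, j)` and `q = j`. [folklore] -/
theorem dir_eq_two_iff (x : Index d) (q : d) :
    dir x q = 2 ↔ ∃ p : Pair d, x = Sum.inr (Sum.inl p) ∧ q = p.1.2 := by
  rw [dir_apply]
  rcases x with i | ⟨⟨i, j⟩, hij⟩ | ⟨⟨i, j⟩, hij⟩
  · simp only [Sum.elim_inl, reduceCtorEq, false_and, exists_false, iff_false]
    split_ifs <;> norm_num
  · dsimp only at hij ⊢
    simp only [Sum.elim_inr, Sum.elim_inl, Sum.inr.injEq, Sum.inl.injEq, exists_eq_left']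
    by_cases hqj : q = j
    · subst hqj; simp [Ne.symm hij]
    · simp only [hqj, if_false, mul_zero, add_zero, iff_false]
      split_ifs <;> norm_num
  · dsimp only at hij ⊢
    simp only [Sum.elim_inr, Sum.inr.injEq, reduceCtorEq, false_and, exists_false, iff_false]
    split_ifs <;> norm_num

/-- `(k_x)_q = -2` exactly when `x` is the second copy of a pair `(i, j)` and `q = j`. [folklore] -/
theorem dir_eq_neg_two_iff (x : Index d) (q : d) :
    dir x q = -2 ↔ ∃ p : Pair d, x = Sum.inr (Sum.inr p) ∧ q = p.1.2 := by
  rw [dir_apply]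
  rcases x with i | ⟨⟨i, j⟩, hij⟩ | ⟨⟨i, j⟩, hij⟩
  · simp only [Sum.elim_inl, reduceCtorEq, false_and, exists_false, iff_false]
    split_ifs <;> norm_num
  · dsimp only at hij ⊢
    simp only [Sum.elim_inr, Sum.elim_inl, Sum.inr.injEq, reduceCtorEq, false_and, exists_false, iff_false]
    split_ifs <;> norm_num
  · dsimp only at hij ⊢
    simp only [Sum.elim_inr, Sum.inr.injEq, Sum.inr.injEq, exists_eq_left']
    by_cases hqj : q = j
    · subst hqj; simp [Ne.symm hij]
    · simp only [hqj, if_false, mul_zero, sub_zero, iff_false]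
      split_ifs <;> norm_num

/-- **The directions `e_i`, `e_i + 2e_j`, `e_i - 2e_j` (`i ≠ j`) are pairwise distinct**, so the
family `dir` enumerates a finite SUBSET `Λ ⊂ ℤ^d` (read off `k_x` the position of the entry `1`
and of the entry `±2`). [folklore] -/
theorem dir_injective : Function.Injective (dir : Index d → d → ℤ) := by
  intro x y h
  have k1 : ∀ q, dir x q = 1 ↔ dir y q = 1 := fun q => by rw [h]
  have k2 : ∀ q, dir x q = 2 ↔ dir y q = 2 := fun q => by rw [h]
  have k3 : ∀ q, dir x q = -2 ↔ dir y q = -2 := fun q => by rw [h]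
  simp only [dir_eq_one_iff, dir_eq_two_iff, dir_eq_neg_two_iff] at k1 k2 k3
  have hb : base x = base y := (k1 (base x)).1 rfl
  rcases x with i | p | p <;> rcases y with i' | p' | p'
  · simpa [base] using hb
  · simpa using (k2 p'.1.2).2 ⟨p', rfl, rfl⟩
  · simpa using (k3 p'.1.2).2 ⟨p', rfl, rfl⟩
  · simpa using (k2 p.1.2).1 ⟨p, rfl, rfl⟩
  · obtain ⟨p₀, hp₀, hq⟩ := (k2 p.1.2).1 ⟨p, rfl, rfl⟩
    simp only [Sum.inr.injEq, Sum.inl.injEq] at hp₀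
    subst hp₀
    simp only [base, Sum.elim_inr, Sum.elim_inl] at hb
    congr 2
    exact Subtype.ext (Prod.ext hb hq)
  · simpa using (k2 p.1.2).1 ⟨p, rfl, rfl⟩
  · simpa using (k3 p.1.2).1 ⟨p, rfl, rfl⟩
  · simpa using (k3 p.1.2).1 ⟨p, rfl, rfl⟩
  · obtain ⟨p₀, hp₀, hq⟩ := (k3 p.1.2).1 ⟨p, rfl, rfl⟩
    simp only [Sum.inr.injEq] at hp₀
    subst hp₀
    simp only [base, Sum.elim_inr] at hb
    congr 2
    exact Subtype.ext (Prod.ext hb hq)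

variable [Fintype d]

/-- `|k_x|² = ∑_l (k_x)_l²` (`1` for `e_i`, `5` for `e_i ± 2e_j`). [folklore] -/
theorem sum_sq_dir (x : Index d) : ∑ l, ((dir x l : ℤ) : ℝ) ^ 2 = dirNormSq x := by
  rcases x with i | p | p
  · simp [dir_apply_cast]
  · have h : p.1.2 ≠ p.1.1 := fun h => p.2 h.symm
    simp [dir_apply_cast, Finset.sum_add_distrib, add_sq, h]
    norm_num
  · have h : p.1.2 ≠ p.1.1 := fun h => p.2 h.symm
    simp [dir_apply_cast, Finset.sum_add_distrib, sub_sq, h]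
    norm_num

/-- The directions are nonzero lattice vectors (`Λ ⊂ ℤ^d ∖ {0}`). [cite: CheskidovLuo2022, Lemma 4.2] -/
theorem dir_ne_zero (x : Index d) : dir x ≠ 0 := by
  intro h
  have hs := sum_sq_dir x
  rw [h] at hs
  simp only [Pi.zero_apply, Int.cast_zero, ne_eq, OfNat.ofNat_ne_zero, not_false_eq_true, zero_pow,
    Finset.sum_const_zero] at hs
  exact (dirNormSq_pos x).ne hs

end Directions

/-! ## The identity matrix, the radius, the coefficients -/

section Coefficients

/-- The identity matrix `Id` as an element of the Pi type `d → d → ℝ`. [folklore] -/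
def idMat [DecidableEq d] : d → d → ℝ := fun i j => if i = j then 1 else 0

/-- Diagonal entries of `Id` are `1`. [folklore] -/
@[simp] theorem idMat_apply_self [DecidableEq d] (i : d) : (idMat : d → d → ℝ) i i = 1 := by
  simp [idMat]

/-- Off-diagonal entries of `Id` are `0`. [folklore] -/
theorem idMat_apply_of_ne [DecidableEq d] {i j : d} (h : i ≠ j) : (idMat : d → d → ℝ) i j = 0 := by
  simp [idMat, h]

variable [Fintype d]

/-- Entries of a matrix in the sup-ball `dist M Id ≤ ρ` are within `ρ` of those of `Id`. [folklore] -/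
theorem abs_sub_idMat_le [DecidableEq d] {M : d → d → ℝ} {ρ : ℝ} (hM : dist M idMat ≤ ρ) (i j : d) :
    |M i j - idMat i j| ≤ ρ := by
  have h := (dist_le_pi_dist (M i) (idMat i) j).trans ((dist_le_pi_dist M idMat i).trans hM)
  rwa [Real.dist_eq] at h

variable (d) in
/-- The radius `r_d = 1/(5(d-1))` of the lemma (positive for `d ≥ 2`). [cite: CheskidovLuo2022, Lemma 4.2] -/
def radius : ℝ := 1 / (5 * ((Fintype.card d : ℝ) - 1))

/-- The squared coefficients `Γ_x(M)²`, affine functionals of `M`: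
`Γ²_{e_i}(M) = M_ii - 1/2`, `Γ²_{e_i + 2e_j}(M) = r_d/4 + M_ij/8`, `Γ²_{e_i - 2e_j}(M) = r_d/4 - M_ij/8`.
[cite: CheskidovLuo2022, Lemma 4.2] -/
def coeffSq (M : d → d → ℝ) : Index d → ℝ :=
  Sum.elim (fun i => M i i - 1 / 2)
    (Sum.elim (fun p => radius d / 4 + M p.1.1 p.1.2 / 8) (fun p => radius d / 4 - M p.1.1 p.1.2 / 8))

/-- The coefficients `Γ_x(M) = √(Γ_x(M)²)` (genuine square roots wherever `Γ_x(M)² ≥ 0`, in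
particular on `B̄(Id, 2r_d)`). [cite: CheskidovLuo2022, Lemma 4.2] -/
def coeff (x : Index d) (M : d → d → ℝ) : ℝ := Real.sqrt (coeffSq M x)

/-- CL22's normalised coefficients `Γ̃_x = |k_x| Γ_x`, for which
`M = ∑_x Γ̃_x(M)² (k_x/|k_x|) ⊗ (k_x/|k_x|)`. [cite: CheskidovLuo2022, Lemma 4.2] -/
def unitCoeff (x : Index d) (M : d → d → ℝ) : ℝ := Real.sqrt (dirNormSq x) * coeff x M

/-- `Γ²_{e_i}(M) = M_ii - 1/2`. [folklore] -/
@[simp] theorem coeffSq_inl (M : d → d → ℝ) (i : d) : coeffSq M (Sum.inl i) = M i i - 1 / 2 := rfl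

/-- `Γ²_{e_i + 2e_j}(M) = r_d/4 + M_ij/8`. [folklore] -/
@[simp] theorem coeffSq_inr_inl (M : d → d → ℝ) (p : Pair d) :
    coeffSq M (Sum.inr (Sum.inl p)) = radius d / 4 + M p.1.1 p.1.2 / 8 := rfl

/-- `Γ²_{e_i - 2e_j}(M) = r_d/4 - M_ij/8`. [folklore] -/
@[simp] theorem coeffSq_inr_inr (M : d → d → ℝ) (p : Pair d) :
    coeffSq M (Sum.inr (Sum.inr p)) = radius d / 4 - M p.1.1 p.1.2 / 8 := rfl

section Card

variable (hd : 2 ≤ Fintype.card d)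
include hd

/-- `1 ≤ d - 1` as reals, for `d ≥ 2`. [folklore] -/
theorem one_le_card_sub_one : (1 : ℝ) ≤ (Fintype.card d : ℝ) - 1 := by
  have : (2 : ℝ) ≤ Fintype.card d := by exact_mod_cast hd
  linarith

/-- `0 < r_d`. [cite: CheskidovLuo2022, Lemma 4.2] -/
theorem radius_pos : 0 < radius d := by
  have := one_le_card_sub_one hd
  unfold radius
  positivity

/-- `r_d ≤ 1/5`. [folklore] -/
theorem radius_le : radius d ≤ 1 / 5 := by
  have h := one_le_card_sub_one hd
  unfold radius
  exact one_div_le_one_div_of_le (by norm_num) (by linarith)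

/-- The calibration `10 · (r_d/4) · (d - 1) = 1/2` behind the diagonal entries. [folklore] -/
theorem radius_mul_card_sub_one : 10 * (radius d / 4) * ((Fintype.card d : ℝ) - 1) = 1 / 2 := by
  have h := one_le_card_sub_one hd
  unfold radius
  field_simp
  ring

end Card

end Coefficients

/-! ## The linear identity and the decomposition -/

section Identity

variable [Fintype d] [DecidableEq d]

/-- `∑_{i ≠ j} F i j = ∑_{i,j} F i j - ∑_i F i i`. [folklore] -/
theorem sum_sum_ite_ne (F : d → d → ℝ) :
    ∑ i, ∑ j, (if i ≠ j then F i j else 0) = ∑ i, ∑ j, F i j - ∑ i, F i i := by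
  rw [← Finset.sum_sub_distrib]
  refine Finset.sum_congr rfl fun i _ => ?_
  rw [← Finset.sum_filter, Finset.filter_ne, Finset.sum_erase_eq_sub (Finset.mem_univ i)]

/-- Sums over the ordered pairs `i ≠ j` as double sums with an indicator. [folklore] -/
theorem sum_pair_eq_sum_dite (g : Pair d → ℝ) :
    ∑ p : Pair d, g p = ∑ i, ∑ j, if h : i ≠ j then g ⟨(i, j), h⟩ else 0 := by
  have h1 : ∀ p : Pair d, g p = (fun q : d × d => if h : q.1 ≠ q.2 then g ⟨q, h⟩ else 0) p.1 :=
    fun p => by dsimp only; rw [dif_pos p.2]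
  rw [Finset.sum_congr rfl fun p _ => h1 p,
    ← Finset.sum_subtype (Finset.univ.filter fun q : d × d => q.1 ≠ q.2) (by simp)
      (fun q : d × d => if h : q.1 ≠ q.2 then g ⟨q, h⟩ else 0),
    Finset.sum_filter, Fintype.sum_prod_type]
  refine Finset.sum_congr rfl fun i _ => Finset.sum_congr rfl fun j _ => ?_
  dsimp only
  by_cases hij : i ≠ j
  · rw [if_pos hij]
  · rw [if_neg hij, dif_neg hij]

/-- The axis family contributes `δ_ab (M_aa - 1/2)`. [folklore] -/
theorem sum_inl_coeffSq (M : d → d → ℝ) (a b : d) :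
    ∑ i : d, coeffSq M (Sum.inl i) *
        (((dir (Sum.inl i : Index d) a : ℤ) : ℝ) * ((dir (Sum.inl i : Index d) b : ℤ) : ℝ)) =
      if a = b then M a a - 1 / 2 else 0 := by
  simp only [coeffSq, Sum.elim_inl, dir_apply_cast, mul_ite, mul_one, mul_zero, Finset.sum_ite_eq,
    Finset.mem_univ, if_true]
  by_cases hab : a = b <;> simp [hab]

/-- The two pair families together contribute
`δ_ab (10 (r_d/4)(d-1) - M_aa) + (M_ab + M_ba)/2`: termwise,
`(r_d/4 + M_ij/8)(δ_ai + 2δ_aj)(δ_bi + 2δ_bj) + (r_d/4 - M_ij/8)(δ_ai - 2δ_aj)(δ_bi - 2δ_bj)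
  = 2(r_d/4)(δ_ai δ_bi + 4 δ_aj δ_bj) + (M_ij/2)(δ_ai δ_bj + δ_aj δ_bi)`, summed over `i ≠ j`. [folklore] -/
theorem sum_inr_coeffSq (M : d → d → ℝ) (a b : d) :
    ∑ p : Pair d, coeffSq M (Sum.inr (Sum.inl p)) *
        (((dir (Sum.inr (Sum.inl p) : Index d) a : ℤ) : ℝ) * ((dir (Sum.inr (Sum.inl p) : Index d) b : ℤ) : ℝ)) +
      ∑ p : Pair d, coeffSq M (Sum.inr (Sum.inr p)) *
        (((dir (Sum.inr (Sum.inr p) : Index d) a : ℤ) : ℝ) * ((dir (Sum.inr (Sum.inr p) : Index d) b : ℤ) : ℝ)) =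
      (if a = b then 10 * (radius d / 4) * ((Fintype.card d : ℝ) - 1) - M a a else 0) +
        (M a b + M b a) / 2 := by
  set T : d → d → ℝ := fun i j =>
    2 * (radius d / 4) * ((if a = i then (1 : ℝ) else 0) * (if b = i then 1 else 0) +
        4 * ((if a = j then (1 : ℝ) else 0) * (if b = j then 1 else 0))) +
      M i j / 2 * ((if a = i then (1 : ℝ) else 0) * (if b = j then 1 else 0) +
        (if a = j then (1 : ℝ) else 0) * (if b = i then 1 else 0)) with hT
  rw [← Finset.sum_add_distrib]
  have hcomb : ∀ p : Pair d, coeffSq M (Sum.inr (Sum.inl p)) *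
        (((dir (Sum.inr (Sum.inl p) : Index d) a : ℤ) : ℝ) * ((dir (Sum.inr (Sum.inl p) : Index d) b : ℤ) : ℝ)) +
      coeffSq M (Sum.inr (Sum.inr p)) *
        (((dir (Sum.inr (Sum.inr p) : Index d) a : ℤ) : ℝ) * ((dir (Sum.inr (Sum.inr p) : Index d) b : ℤ) : ℝ)) =
      T p.1.1 p.1.2 := by
    intro p
    simp only [coeffSq, Sum.elim_inl, Sum.elim_inr, dir_apply_cast, hT]
    ring
  rw [Finset.sum_congr rfl fun p _ => hcomb p, sum_pair_eq_sum_dite]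
  simp only [dite_eq_ite]
  rw [sum_sum_ite_ne T]
  simp only [hT, mul_add, Finset.sum_add_distrib, mul_ite, mul_one, mul_zero, Finset.sum_ite_eq,
    Finset.mem_univ, if_true, Finset.sum_const, Finset.card_univ, nsmul_eq_mul, Finset.sum_ite_irrel]
  by_cases hab : a = b
  · subst hab
    simp only [if_true]
    ring
  · simp only [hab, if_false]
    ring

/-- **The linear identity** `∑_x Γ_x(M)² (k_x)_a (k_x)_b = (M_ab + M_ba)/2` for EVERY matrix `M`
(no symmetry, no smallness), `d ≥ 2`. [cite: CheskidovLuo2022, Lemma 4.2 (proof device, after Nash 1954)] -/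
theorem sum_coeffSq_mul_dir_mul_dir (hd : 2 ≤ Fintype.card d) (M : d → d → ℝ) (a b : d) :
    ∑ x, coeffSq M x * (((dir x a : ℤ) : ℝ) * ((dir x b : ℤ) : ℝ)) = (M a b + M b a) / 2 := by
  rw [Fintype.sum_sum_type, Fintype.sum_sum_type, sum_inl_coeffSq, sum_inr_coeffSq,
    radius_mul_card_sub_one hd]
  by_cases hab : a = b
  · subst hab
    simp only [if_true]
    ring
  · simp only [hab, if_false]
    ring

/-- **Nash's identity for symmetric matrices**: `M_ab = ∑_x Γ_x(M)² (k_x)_a (k_x)_b` for every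
symmetric `M` and `d ≥ 2` (at the level of the affine `Γ_x²`, no smallness is needed).
[cite: CheskidovLuo2022, Lemma 4.2] -/
theorem nash_identity (hd : 2 ≤ Fintype.card d) {M : d → d → ℝ} (hsym : ∀ i j, M i j = M j i)
    (a b : d) : M a b = ∑ x, coeffSq M x * (((dir x a : ℤ) : ℝ) * ((dir x b : ℤ) : ℝ)) := by
  rw [sum_coeffSq_mul_dir_mul_dir hd, ← hsym a b]
  ring

/-! ### Signs of the squared coefficients near `Id` -/

/-- On the closed sup-ball `B̄(Id, 2r_d)` all squared coefficients are nonnegative: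
`M_ii - 1/2 ≥ 1/2 - 2r_d ≥ 1/10` and `r_d/4 ± M_ij/8 ≥ r_d/4 - 2r_d/8 = 0`. [folklore] -/
theorem coeffSq_nonneg (hd : 2 ≤ Fintype.card d) {M : d → d → ℝ} (hM : dist M idMat ≤ 2 * radius d)
    (x : Index d) : 0 ≤ coeffSq M x := by
  have hr := radius_le hd
  rcases x with i | ⟨⟨i, j⟩, hij⟩ | ⟨⟨i, j⟩, hij⟩
  · have h := abs_sub_idMat_le hM i i
    rw [idMat_apply_self] at h
    have := (abs_le.mp h).1
    simp only [coeffSq_inl]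
    linarith
  · dsimp only at hij
    have h := abs_sub_idMat_le hM i j
    rw [idMat_apply_of_ne hij, sub_zero] at h
    have := (abs_le.mp h).1
    simp only [coeffSq_inr_inl]
    linarith
  · dsimp only at hij
    have h := abs_sub_idMat_le hM i j
    rw [idMat_apply_of_ne hij, sub_zero] at h
    have := (abs_le.mp h).2
    simp only [coeffSq_inr_inr]
    linarith

/-- On the open sup-ball `B(Id, 2r_d)` all squared coefficients are positive. [folklore] -/
theorem coeffSq_pos (hd : 2 ≤ Fintype.card d) {M : d → d → ℝ} (hM : dist M idMat < 2 * radius d)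
    (x : Index d) : 0 < coeffSq M x := by
  have hr := radius_le hd
  have hlt : ∀ i j, |M i j - idMat i j| < 2 * radius d := fun i j =>
    lt_of_le_of_lt ((dist_le_pi_dist (M i) (idMat i) j).trans (dist_le_pi_dist M idMat i))
      (by simpa [Real.dist_eq] using hM)
  rcases x with i | ⟨⟨i, j⟩, hij⟩ | ⟨⟨i, j⟩, hij⟩
  · have h := hlt i i
    rw [idMat_apply_self] at h
    have := (abs_lt.mp h).1
    simp only [coeffSq_inl]
    linarith
  · dsimp only at hij
    have h := hlt i j
    rw [idMat_apply_of_ne hij, sub_zero] at h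
    have := (abs_lt.mp h).1
    simp only [coeffSq_inr_inl]
    linarith
  · dsimp only at hij
    have h := hlt i j
    rw [idMat_apply_of_ne hij, sub_zero] at h
    have := (abs_lt.mp h).2
    simp only [coeffSq_inr_inr]
    linarith

/-- **Uniform positivity on `B̄(Id, r_d)`**: `Γ_x(M)² ≥ r_d/8` (`M_ii - 1/2 ≥ 3/10 ≥ r_d/8` and
`r_d/4 ± M_ij/8 ≥ r_d/4 - r_d/8`). [folklore] -/
theorem le_coeffSq (hd : 2 ≤ Fintype.card d) {M : d → d → ℝ} (hM : dist M idMat ≤ radius d)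
    (x : Index d) : radius d / 8 ≤ coeffSq M x := by
  have hr := radius_le hd
  rcases x with i | ⟨⟨i, j⟩, hij⟩ | ⟨⟨i, j⟩, hij⟩
  · have h := abs_sub_idMat_le hM i i
    rw [idMat_apply_self] at h
    have := (abs_le.mp h).1
    simp only [coeffSq_inl]
    linarith
  · dsimp only at hij
    have h := abs_sub_idMat_le hM i j
    rw [idMat_apply_of_ne hij, sub_zero] at h
    have := (abs_le.mp h).1
    simp only [coeffSq_inr_inl]
    linarith
  · dsimp only at hij
    have h := abs_sub_idMat_le hM i j
    rw [idMat_apply_of_ne hij, sub_zero] at h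
    have := (abs_le.mp h).2
    simp only [coeffSq_inr_inr]
    linarith

/-- `Γ_x(M)² = (Γ_x(M))²` on `B̄(Id, 2r_d)` (the square root is genuine there). [folklore] -/
theorem coeff_sq (hd : 2 ≤ Fintype.card d) {M : d → d → ℝ} (hM : dist M idMat ≤ 2 * radius d)
    (x : Index d) : coeff x M ^ 2 = coeffSq M x :=
  Real.sq_sqrt (coeffSq_nonneg hd hM x)

/-- `r_d/8 ≤ Γ_x(M)²` on `B̄(Id, r_d)`, for the genuine coefficient `Γ_x = √(Γ_x²)`. [folklore] -/
theorem le_coeff_sq (hd : 2 ≤ Fintype.card d) {M : d → d → ℝ} (hM : dist M idMat ≤ radius d)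
    (x : Index d) : radius d / 8 ≤ coeff x M ^ 2 := by
  rw [coeff_sq hd (hM.trans (by linarith [radius_pos hd])) x]
  exact le_coeffSq hd hM x

/-- **The rank-one decomposition** `M_ab = ∑_x Γ_x(M)² (k_x)_a (k_x)_b`, i.e.
`M = ∑_x Γ_x(M)² k_x ⊗ k_x`, for every symmetric `M` in the closed sup-ball `B̄(Id, 2r_d)` (which
contains the Frobenius ball of the same radius), `d ≥ 2`. [cite: CheskidovLuo2022, Lemma 4.2] -/
theorem decomposition (hd : 2 ≤ Fintype.card d) {M : d → d → ℝ} (hsym : ∀ i j, M i j = M j i)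
    (hM : dist M idMat ≤ 2 * radius d) (a b : d) :
    M a b = ∑ x, coeff x M ^ 2 * (((dir x a : ℤ) : ℝ) * ((dir x b : ℤ) : ℝ)) := by
  rw [nash_identity hd hsym a b]
  exact Finset.sum_congr rfl fun x _ => by rw [coeff_sq hd hM x]

/-- **The decomposition in CL22's normalised form** `M = ∑_x Γ̃_x(M)² (k_x/|k_x|) ⊗ (k_x/|k_x|)`,
`Γ̃_x = |k_x| Γ_x`, entrywise: `M_ab = ∑_x Γ̃_x(M)² (k_x)_a (k_x)_b / |k_x|²`, for symmetric `M` in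
`B̄(Id, 2r_d)`. [cite: CheskidovLuo2022, Lemma 4.2] -/
theorem decomposition_unit (hd : 2 ≤ Fintype.card d) {M : d → d → ℝ} (hsym : ∀ i j, M i j = M j i)
    (hM : dist M idMat ≤ 2 * radius d) (a b : d) :
    M a b = ∑ x, unitCoeff x M ^ 2 *
      (((dir x a : ℤ) : ℝ) * ((dir x b : ℤ) : ℝ) / ∑ l, ((dir x l : ℤ) : ℝ) ^ 2) := by
  rw [decomposition hd hsym hM a b]
  refine Finset.sum_congr rfl fun x _ => ?_
  rw [sum_sq_dir, unitCoeff, mul_pow, Real.sq_sqrt (dirNormSq_pos x).le, mul_div_assoc', mul_comm (dirNormSq x),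
    mul_assoc, mul_div_assoc, mul_div_cancel_left₀ _ (dirNormSq_pos x).ne']

/-! ## Smoothness -/

omit [DecidableEq d] in
/-- Each `Γ_x²` is `C^∞` on all of `ℝ^{d×d}` (an affine function of one entry). [folklore] -/
theorem contDiff_coeffSq (x : Index d) {n : WithTop ℕ∞} :
    ContDiff ℝ n fun M : d → d → ℝ => coeffSq M x := by
  have h : ∀ i j : d, ContDiff ℝ n fun M : d → d → ℝ => M i j :=
    fun i j => contDiff_apply_apply ℝ ℝ i j
  rcases x with i | p | p
  · simp only [coeffSq_inl]
    exact (h i i).sub contDiff_const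
  · simp only [coeffSq_inr_inl]
    exact contDiff_const.add ((h p.1.1 p.1.2).div_const 8)
  · simp only [coeffSq_inr_inr]
    exact contDiff_const.sub ((h p.1.1 p.1.2).div_const 8)

/-- **Each `Γ_x` is `C^∞` on the open sup-ball `B(Id, 2r_d)`** (square root of a smooth positive
function), `d ≥ 2`; CL22's `Γ_k ∈ C^∞(𝒩)` for `𝒩 ⊂ B(Id, 2r_d)`. [cite: CheskidovLuo2022, Lemma 4.2] -/
theorem contDiffOn_coeff (hd : 2 ≤ Fintype.card d) (x : Index d) {n : WithTop ℕ∞} :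
    ContDiffOn ℝ n (coeff x) (ball (idMat : d → d → ℝ) (2 * radius d)) :=
  (contDiff_coeffSq x).contDiffOn.sqrt fun _ hM => (coeffSq_pos hd (mem_ball.mp hM) x).ne'

/-- The normalised coefficients `Γ̃_x = |k_x| Γ_x` are `C^∞` on `B(Id, 2r_d)`. [cite: CheskidovLuo2022, Lemma 4.2] -/
theorem contDiffOn_unitCoeff (hd : 2 ≤ Fintype.card d) (x : Index d) {n : WithTop ℕ∞} :
    ContDiffOn ℝ n (unitCoeff x) (ball (idMat : d → d → ℝ) (2 * radius d)) :=
  contDiffOn_const.mul (contDiffOn_coeff hd x)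

/-- `Γ_x` is `C^∞` at every point of the open ball `B(Id, 2r_d)`. [folklore] -/
theorem contDiffAt_coeff (hd : 2 ≤ Fintype.card d) (x : Index d) {n : WithTop ℕ∞} {M : d → d → ℝ}
    (hM : dist M idMat < 2 * radius d) : ContDiffAt ℝ n (coeff x) M :=
  (contDiffOn_coeff hd x).contDiffAt (isOpen_ball.mem_nhds (mem_ball.mpr hM))

/-- **Uniform bounds on all derivatives of `Γ_x` on `B̄(Id, r_d)`**: for every `m` there is `C`
with `‖D^m Γ_x(M)‖ ≤ C` whenever `dist M Id ≤ r_d` (continuity of `D^m Γ_x` on the open ball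
`B(Id, 2r_d)` and compactness of the closed ball of radius `r_d`). [folklore] -/
theorem exists_bound_iteratedFDeriv_coeff (hd : 2 ≤ Fintype.card d) (x : Index d) (m : ℕ) :
    ∃ C : ℝ, ∀ M : d → d → ℝ, dist M idMat ≤ radius d → ‖iteratedFDeriv ℝ m (coeff x) M‖ ≤ C := by
  set U : Set (d → d → ℝ) := ball idMat (2 * radius d) with hU
  have hUopen : IsOpen U := isOpen_ball
  have hsmooth : ContDiffOn ℝ ∞ (coeff x) U := contDiffOn_coeff hd x
  have hcont : ContinuousOn (iteratedFDerivWithin ℝ m (coeff x) U) U :=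
    hsmooth.continuousOn_iteratedFDerivWithin (by exact_mod_cast le_top) hUopen.uniqueDiffOn
  have hcont' : ContinuousOn (iteratedFDeriv ℝ m (coeff x)) U :=
    hcont.congr fun M hM => (iteratedFDerivWithin_of_isOpen m hUopen hM).symm
  have hsub : closedBall idMat (radius d) ⊆ U := by
    intro M hM
    rw [hU, mem_ball]
    exact (mem_closedBall.mp hM).trans_lt (by linarith [radius_pos hd])
  obtain ⟨C, hC⟩ := (isCompact_closedBall idMat (radius d)).exists_bound_of_continuousOn
    (hcont'.mono hsub)
  exact ⟨C, fun M hM => hC M (mem_closedBall.mpr hM)⟩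

/-! ## The lemma in its printed shapes -/

/-- **The geometric lemma near the identity, family form (every `d ≥ 2`)**: there is `r > 0`
(namely `r = r_d = 1/(5(d-1))`) such that the finitely many pairwise distinct nonzero lattice
directions `k_x ∈ ℤ^d` (`x : Index d`; `e_i`, `e_i ± 2e_j`) and the functions `Γ_x = coeff x`
satisfy: `Γ_x ∈ C^∞(B(Id, 2r))`; `M = ∑_x Γ_x(M)² k_x ⊗ k_x` for every symmetric `M` with
`dist M Id ≤ 2r`; `Γ_x(M)² ≥ r/8` for `dist M Id ≤ r`; and `sup_{B̄(Id,r)} ‖D^m Γ_x‖ < ∞` for all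
`m`. This is Lemma 4.2 of CL22 for the compact sets `𝒩 = B̄(Id, ρ) ⊂ 𝒮₊`, `ρ ≤ 2r` (sup-balls of
`ℝ^{d×d}`, containing the Frobenius balls), in the un-normalised shape `k ⊗ k` (CP25, Lemma 6.1);
the normalised shape is `geometric_lemma_finset`. [cite: CheskidovLuo2022, Lemma 4.2] -/
theorem geometric_lemma (hd : 2 ≤ Fintype.card d) :
    ∃ r : ℝ, 0 < r ∧
      (∀ x : Index d, dir x ≠ 0) ∧ Function.Injective (dir : Index d → d → ℤ) ∧
      (∀ x : Index d, ContDiffOn ℝ ∞ (coeff x) (ball (idMat : d → d → ℝ) (2 * r))) ∧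
      (∀ M : d → d → ℝ, (∀ i j, M i j = M j i) → dist M idMat ≤ 2 * r →
        ∀ a b, M a b = ∑ x, coeff x M ^ 2 * (((dir x a : ℤ) : ℝ) * ((dir x b : ℤ) : ℝ))) ∧
      (∀ M : d → d → ℝ, dist M idMat ≤ r → ∀ x : Index d, r / 8 ≤ coeff x M ^ 2) ∧
      ∀ (x : Index d) (m : ℕ), ∃ C : ℝ, ∀ M : d → d → ℝ, dist M idMat ≤ r →
        ‖iteratedFDeriv ℝ m (coeff x) M‖ ≤ C :=
  ⟨radius d, radius_pos hd, dir_ne_zero, dir_injective, fun x => contDiffOn_coeff hd x,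
    fun _ hsym hM a b => decomposition hd hsym hM a b, fun _ hM x => le_coeff_sq hd hM x,
    fun x m => exists_bound_iteratedFDeriv_coeff hd x m⟩

/-- **The geometric lemma near the identity in CL22's printed shape (every `d ≥ 2`)**: there exist
`r > 0`, a finite set `Λ ⊂ ℤ^d` of nonzero vectors and functions `Γ_k`, `k ∈ Λ`, smooth on the
open sup-ball `B(Id, 2r)` of `ℝ^{d×d}`, such that every symmetric `R` with `dist R Id ≤ 2r`
satisfies `R = ∑_{k ∈ Λ} Γ_k(R)² e_k ⊗ e_k`, `e_k = k/|k|`, i.e. entrywise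
`R_ab = ∑_{k ∈ Λ} Γ_k(R)² k_a k_b / |k|²` — Lemma 4.2 for the compact sets `𝒩 = B̄(Id, ρ)`,
`ρ ≤ 2r` (witnesses: `Λ = image dir`, `Γ_{k_x} = unitCoeff x`, `r = r_d`).
[cite: CheskidovLuo2022, Lemma 4.2] -/
theorem geometric_lemma_finset (hd : 2 ≤ Fintype.card d) :
    ∃ (r : ℝ) (Λ : Finset (d → ℤ)) (Γ : (d → ℤ) → (d → d → ℝ) → ℝ), 0 < r ∧ (0 : d → ℤ) ∉ Λ ∧
      (∀ k ∈ Λ, ContDiffOn ℝ ∞ (Γ k) (ball (idMat : d → d → ℝ) (2 * r))) ∧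
      ∀ R : d → d → ℝ, (∀ i j, R i j = R j i) → dist R idMat ≤ 2 * r →
        ∀ a b, R a b = ∑ k ∈ Λ, Γ k R ^ 2 * (((k a : ℤ) : ℝ) * ((k b : ℤ) : ℝ) / ∑ l, ((k l : ℤ) : ℝ) ^ 2) := by
  classical
  -- transport the coefficients to the image set along the injective enumeration `dir`
  set Γ : (d → ℤ) → (d → d → ℝ) → ℝ := fun k =>
    if h : ∃ x : Index d, dir x = k then unitCoeff h.choose else 0 with hΓ
  have hΓdir : ∀ x : Index d, Γ (dir x) = unitCoeff x := by
    intro x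
    have h : ∃ y : Index d, dir y = dir x := ⟨x, rfl⟩
    rw [hΓ]
    dsimp only
    rw [dif_pos h, dir_injective h.choose_spec]
  refine ⟨radius d, Finset.univ.image dir, Γ, radius_pos hd, ?_, ?_, ?_⟩
  · simp only [Finset.mem_image, Finset.mem_univ, true_and, not_exists]
    exact fun x => dir_ne_zero x
  · intro k hk
    obtain ⟨x, -, rfl⟩ := Finset.mem_image.mp hk
    rw [hΓdir]
    exact contDiffOn_unitCoeff hd x
  · intro R hsym hR a b
    rw [Finset.sum_image fun x _ y _ h => dir_injective h, decomposition_unit hd hsym hR a b]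
    exact Finset.sum_congr rfl fun x _ => by rw [hΓdir]

end Identity

end Literature.Analysis.FluidPDE.NashGeometric
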